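import HarnessLib
import Literature.MathematicalPhysics.QuantumFieldTheory.Balaban1983to89.T3FinestHeightTail

/-!
# Route `SmallFieldWidening` — crux r3 `LargeFieldMassRefinementTail` (stmt-QuantumFields-22884), line `birth`:
# the BOOKKEEPING HALF of the registered stub `stub_perRunMass`, PROVED (support file; the crux stays open)

Seat `ym-line-sfw-p2-w3` (width seat 3/3 of the lead `ym-line-sfw-p2`).  The BC3 birth skeleton
(`Cruxes/LargeFieldMassRefinementTail/Lines/birth.lean`) composes the crux from `PerRunMass` (the Gibbs mass of the complement of the
ALL-HEIGHTS small-field event `histGood F ℰp θ K 0` of run `K` is at most `Σ_{i ≤ K} C·L^{3(m+i)}·exp(−c·p(g_i)²)`,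
`g_i = √(γL^{−i})`, with `C, c` UNIFORM in the family (`F.L = L`), in `γ ≤ γ₁` and in `K`) and `SeriesTail` (real analysis).
`PerRunMass` itself is «per-plaquette large-field tail at every height» + «union bound»; this file proves the second half:

* `perRunMass_of_perPlaquetteTail` — if every BLOCK-AVERAGED plaquette at every height `1 ≤ j ≤ K` of every run `K` has Gibbs tail
  `Gibbs_K{θ(K−j) ≤ |Ū^{j}(∂p) − 1|} ≤ C·β_{K−j}^A·exp(−c·p(g_{K−j})²)` with `(C, A, c)` uniform in `F` (`F.L = L`) and `0 < γ ≤ γ₁ ≤ 1`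
  (the per-plaquette schema of `T3AveragedTailProfile`, [Balaban1985UV3] (71) p.273, made `γ`- and volume-uniform), then the body of
  `PerRunMass` holds at `L` with explicit constants `c' = min(c, ¼)/2`, `C' = 72·max(C, 2e^{24}c₀⁻³)·exp(2A'²/(c'… ))`:
  (i) the bare height `j = 0` is the tree's chessboard tail `T3FinestHeightTail.gibbsMeasure_real_dist1_ge_le` (`(√β)⁹ ≤ β⁵`);
  (ii) `(histGood K 0)ᶜ ⊆ ⋃_{j ≤ K} {¬PlaqSmall θ(K−j) Ū^{j}}` and `measureReal_biUnion_finset_le`;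
  (iii) per height, `T3CruxEstimates.real_not_plaqSmall_comp_le_sum` and `#Plaq(T^{(j)}_K) ≤ 72·L^{3(m+K−j)}`;
  (iv) THE POINT OF THIS FILE: the polynomial prefactor `β_i^A = (γL^{−i})^{−A}` is absorbed into `exp(−(c/2)p(g_i)²)` UNIFORMLY IN
  `γ ≤ 1` (`p(g) = b₀(1 + log g⁻¹)^{p₀} ≥ b₀(1 + log g⁻¹)` for `p₀ ≥ 1`; complete the square in `u = 1 + log g⁻¹`) — the tree's
  `T3BareTailProfile.bareTailAt` / `T3AveragedTailProfile.perHeight_bound` absorb it into `2^{−i}` at the price of a factor `γ^{−5}` /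
  `γ^{−A}`, which is useless here because the crux applies the bound to the REFINED families at couplings `γL^{−n} → 0`;
  (v) re-indexing `i = K − j` (`Finset.sum_range_reflect`).
* `perRunMass_of_perPlaquetteTail'` — the same under the stub's quantifier prefix `∀ L, ∃ b₀ p₀ γ₁ …`, concluding the body of
  `PerRunMass` VERBATIM (the lead closes `stub_perRunMass` by `exact` once the per-plaquette averaged-height tail is supplied).

WHAT THIS IS NOT: not the per-plaquette tail at the averaged heights `j ≥ 1` (the crux's located, unprinted content: a (71)-type
large-field probability bound for block-averaged plaquettes under the interacting `SU(2)` Gibbs law, `γ`- and volume-uniform), not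
`SeriesTail`, not the crux, and no summit: the line bears on the RECORD rung R3 (`YM3TorusSU2`), not on `YangMills`.
-/

noncomputable section

open MeasureTheory Filter Topology
open scoped BigOperators
open Literature.MathematicalPhysics.QuantumFieldTheory.Balaban1983to89
open Literature.MathematicalPhysics.QuantumFieldTheory.Balaban1983to89.Missing
open Literature.MathematicalPhysics.QuantumFieldTheory.Balaban1983to89.T3ContinuumYM3Torus
open Literature.MathematicalPhysics.QuantumFieldTheory.Balaban1983to89.T3UnitScaleTilt
open Literature.MathematicalPhysics.QuantumFieldTheory.Balaban1983to89.T3UnitLawDensityEML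
open Literature.MathematicalPhysics.QuantumFieldTheory.Balaban1983to89.T3CruxEstimates
open Literature.MathematicalPhysics.QuantumFieldTheory.Balaban1983to89.T3FinestHeightTail

namespace Summit.QuantumFields.YangMills.Theorems

/-! ## §1 Arithmetic: the polynomial prefactor is absorbed uniformly in the coupling -/

/-- Completing the square: `b t − a t² ≤ b²/(4a)` for `a > 0`. -/
private theorem sfwRun_quadratic_le {a : ℝ} (ha : 0 < a) (b t : ℝ) : b * t - a * t ^ 2 ≤ b ^ 2 / (4 * a) := by
  rw [le_div_iff₀ (by positivity)]
  nlinarith [sq_nonneg (2 * a * t - b)]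

/-- `(√y)⁹ ≤ y⁵` for `y ≥ 1`. -/
private theorem sfwRun_sqrt_pow_nine_le {y : ℝ} (hy : 1 ≤ y) : Real.sqrt y ^ 9 ≤ y ^ 5 := by
  have hy0 : 0 ≤ y := zero_le_one.trans hy
  have hs : Real.sqrt y ^ 2 = y := Real.sq_sqrt hy0
  have hsy : Real.sqrt y ≤ y := by
    rw [Real.sqrt_le_left hy0]
    nlinarith
  calc Real.sqrt y ^ 9 = (Real.sqrt y ^ 2) ^ 4 * Real.sqrt y := by ring
    _ = y ^ 4 * Real.sqrt y := by rw [hs]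
    _ ≤ y ^ 4 * y := by gcongr
    _ = y ^ 5 := by ring

/-- **UNIFORM ABSORPTION OF THE POLYNOMIAL PREFACTOR** (`0 < x ≤ 1`, `0 < b₀`, `1 ≤ p₀`, `0 < c`, `A : ℕ`): with `g = √x` and
Bałaban's profile `p(g) = b₀(1 + log g⁻¹)^{p₀}` ([Balaban1985UV3] (7) p.257),
`x^{−A}·exp(−c·p(g)²) ≤ exp(2A²/(c b₀²))·exp(−(c/2)·p(g)²)` — because `x^{−A} = exp(2A(u − 1))`, `p(g) ≥ b₀u` with `u = 1 + log g⁻¹ ≥ 1`,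
and `2Au − (c b₀²/2)u² ≤ 2A²/(c b₀²)`.  No smallness of `x` beyond `x ≤ 1` is used, so the constant is uniform in the coupling. -/
theorem sfwRun_inv_pow_mul_exp_le {x b₀ p₀ c : ℝ} (hx : 0 < x) (hx1 : x ≤ 1) (hb₀ : 0 < b₀) (hp₀ : 1 ≤ p₀)
    (hc : 0 < c) (A : ℕ) :
    x⁻¹ ^ A * Real.exp (-(c * B10.pFun b₀ p₀ (Real.sqrt x) ^ 2)) ≤
      Real.exp (2 * (A : ℝ) ^ 2 / (c * b₀ ^ 2)) * Real.exp (-(c / 2 * B10.pFun b₀ p₀ (Real.sqrt x) ^ 2)) := by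
  set g : ℝ := Real.sqrt x with hg
  have hlogg : Real.log g⁻¹ = -Real.log x / 2 := by
    rw [Real.log_inv, hg, Real.log_sqrt hx.le]; ring
  have hlogx : Real.log x ≤ 0 := Real.log_nonpos hx.le hx1
  set u : ℝ := 1 + Real.log g⁻¹ with hu
  have hu1 : 1 ≤ u := by rw [hu, hlogg]; linarith
  have hu0 : 0 ≤ u := zero_le_one.trans hu1
  have hpF : B10.pFun b₀ p₀ g = b₀ * u ^ p₀ := rfl
  have hup : u ≤ u ^ p₀ := Real.self_le_rpow_of_one_le hu1 hp₀
  have hpF_ge : b₀ * u ≤ B10.pFun b₀ p₀ g := by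
    rw [hpF]; exact mul_le_mul_of_nonneg_left hup hb₀.le
  -- `x⁻¹ ^ A = exp (2A(u − 1))`
  have hxA : x⁻¹ ^ A = Real.exp (2 * (A : ℝ) * (u - 1)) := by
    have e1 : u - 1 = -Real.log x / 2 := by rw [hu, hlogg]; ring
    rw [e1, show 2 * (A : ℝ) * (-Real.log x / 2) = (A : ℝ) * Real.log x⁻¹ by rw [Real.log_inv]; ring,
      Real.exp_nat_mul, Real.exp_log (inv_pos.mpr hx)]
  rw [hxA, ← Real.exp_add, ← Real.exp_add]
  refine Real.exp_le_exp.mpr ?_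
  have hsq : (b₀ * u) ^ 2 ≤ B10.pFun b₀ p₀ g ^ 2 := pow_le_pow_left₀ (by positivity) hpF_ge 2
  have hq := sfwRun_quadratic_le (a := c * b₀ ^ 2 / 2) (by positivity) (2 * A) u
  have he : (2 * (A : ℝ)) ^ 2 / (4 * (c * b₀ ^ 2 / 2)) = 2 * (A : ℝ) ^ 2 / (c * b₀ ^ 2) := by
    field_simp; ring
  rw [he] at hq
  have hA0 : (0 : ℝ) ≤ A := Nat.cast_nonneg A
  nlinarith [mul_le_mul_of_nonneg_left hsq hc.le]

/-! ## §2 Counting plaquettes at height `j` of run `K` -/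

/-- The height-`j` lattice of the `K`-th approximation has `2L^{m+K−j}` sites per direction (`j ≤ K`)
([Balaban1985UV3] (1)–(3) p.256). -/
private theorem sfwRun_sitesPerDir_eq (F : T3Family) {K j : ℕ} (hj : j ≤ K) :
    (F.P K).sitesPerDir j = 2 * F.L ^ (F.m + (K - j)) := by
  show 2 * F.L ^ (F.m + K - j) = 2 * F.L ^ (F.m + (K - j))
  rw [show F.m + K - j = F.m + (K - j) by omega]

/-- `#plaquettes of T^{(j)}_K ≤ 72·L^{3(m+K−j)}` (`≤ 9` plane labels per site, `(2L^{m+K−j})³` sites). -/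
private theorem sfwRun_card_plaq_le (F : T3Family) {K j : ℕ} (hj : j ≤ K) :
    (Fintype.card (Plaq (F.P K) j) : ℝ) ≤ 72 * (F.L : ℝ) ^ (3 * (F.m + (K - j))) := by
  have h1 : Fintype.card (Plaq (F.P K) j) = Fintype.card (Literature.MathematicalPhysics.QuantumFieldTheory.Plaquette 3 ((F.P K).sitesPerDir j)) :=
    Fintype.card_congr (plaqEquiv (P := F.P K) j)
  have h2 : Fintype.card (Literature.MathematicalPhysics.QuantumFieldTheory.Plaquette 3 ((F.P K).sitesPerDir j)) ≤ ((F.P K).sitesPerDir j) ^ 3 * 3 ^ 2 := by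
    rw [Fintype.card_prod, Fintype.card_fun, ZMod.card, Fintype.card_fin]
    gcongr
    calc Fintype.card {p : Fin 3 × Fin 3 // p.1 < p.2} ≤ Fintype.card (Fin 3 × Fin 3) := Fintype.card_subtype_le _
      _ = 3 ^ 2 := by rw [Fintype.card_prod, Fintype.card_fin]; norm_num
  rw [h1]
  calc (Fintype.card (Literature.MathematicalPhysics.QuantumFieldTheory.Plaquette 3 ((F.P K).sitesPerDir j)) : ℝ) ≤ (((F.P K).sitesPerDir j) ^ 3 * 3 ^ 2 : ℕ) := by
        exact_mod_cast h2
    _ = 72 * (F.L : ℝ) ^ (3 * (F.m + (K - j))) := by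
        rw [sfwRun_sitesPerDir_eq F hj]; push_cast; ring

/-! ## §3 The complement of the all-heights small-field event is a union over heights -/

/-- `(histGood F ℰp θ K 0)ᶜ ⊆ ⋃_{j ≤ K} {U : ¬PlaqSmall θ(K−j) (Ū^{j})}`: a history that is not small at ALL heights is large at
SOME height `j ≤ K` ([Balaban1985UV3] (7) p.257: the decomposition of unity, complement of its all-small term). -/
theorem sfwRun_compl_histGood_zero_subset (F : T3Family) (θ : ℕ → ℝ) (K : ℕ) :
    (histGood F ℰp θ K 0)ᶜ ⊆ ⋃ j ∈ Finset.range (K + 1),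
      {U : GaugeField (F.P K) 0 (Matrix.specialUnitaryGroup (Fin 2) ℂ) |
        ¬ PlaqSmall (θ (K - j)) (Averaging.iter (fun i => BlockAveraging.blockAvg (P := F.P K) (j := i) ℰp) j U)} := by
  intro U hU
  simp only [Set.mem_compl_iff, histGood, Set.mem_setOf_eq, not_forall] at hU
  obtain ⟨j, hj, hbad⟩ := hU
  simp only [Set.mem_iUnion, Finset.mem_range, Set.mem_setOf_eq]
  exact ⟨j, by omega, hbad⟩

/-! ## §4 The bookkeeping half of `stub_perRunMass` -/

/-- **`PerRunMass` AT BLOCK SIZE `L` FROM A UNIFORM PER-PLAQUETTE TAIL AT THE AVERAGED HEIGHTS** (`0 < b₀`, `1 ≤ p₀`, `γ₁ ≤ 1`,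
`C ≥ 0`, `c > 0`, `A : ℕ`).  If for every family `F` with `F.L = L`, every `0 < γ ≤ γ₁`, every run `K`, every height
`1 ≤ j ≤ K` and every plaquette `p` of `T^{(j)}_K`,
`Gibbs_K{θ(K−j) ≤ |Ū^{j}(∂p) − 1|} ≤ C·β_{K−j}^A·exp(−c·p(g_{K−j})²)` (`β_i = (γL^{−i})⁻¹`, `g_i = √(γL^{−i})`, `θ = θBal`), then there
are `c' > 0`, `C' ≥ 0` with, for all such `F, γ` and every `K`,
`Gibbs_K((histGood F ℰp θ K 0)ᶜ) ≤ Σ_{i ≤ K} C'·L^{3(m+i)}·exp(−c'·p(g_i)²)` — the conclusion of the stub `PerRunMass` at `L`.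
The bare height `j = 0` is supplied by the tree (`T3FinestHeightTail.gibbsMeasure_real_dist1_ge_le`). -/
theorem perRunMass_of_perPlaquetteTail (L : ℕ) {b₀ p₀ γ₁ C c : ℝ} {A : ℕ} (hb₀ : 0 < b₀) (hp₀ : 1 ≤ p₀)
    (hγ₁1 : γ₁ ≤ 1) (hC : 0 ≤ C) (hc : 0 < c)
    (h : ∀ (F : T3Family) (γ : ℝ), F.L = L → 0 < γ → γ ≤ γ₁ → ∀ (K j : ℕ), 1 ≤ j → j ≤ K →
      ∀ p : Plaq (F.P K) j,
        (gibbsK F ℰp γ K).real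
            {U | θBal F.L γ b₀ p₀ (K - j) ≤
              GaugeGroup.dist1 (GaugeField.plaqHol
                (Averaging.iter (fun i => BlockAveraging.blockAvg (P := F.P K) (j := i) ℰp) j U) p)} ≤
          C * (F.scheme ℰp γ).β (K - j) ^ A *
            Real.exp (-(c * B10.pFun b₀ p₀ (Real.sqrt (γ * ((F.L : ℝ)⁻¹) ^ (K - j))) ^ 2))) :
    ∃ c' C' : ℝ, 0 < c' ∧ 0 ≤ C' ∧ ∀ (F : T3Family) (γ : ℝ), F.L = L → 0 < γ → γ ≤ γ₁ → ∀ K : ℕ,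
      (gibbsK F ℰp γ K).real (histGood F ℰp (θBal F.L γ b₀ p₀) K 0)ᶜ ≤
        ∑ i ∈ Finset.range (K + 1), C' * (F.L : ℝ) ^ (3 * (F.m + i)) *
          Real.exp (-(c' * (B10.pFun b₀ p₀ (Real.sqrt (γ * ((F.L : ℝ)⁻¹) ^ i))) ^ 2)) := by
  -- the bare height from the tree (chessboard estimate, uniform in the volume)
  obtain ⟨c₀, hc₀, -, hbare⟩ := gibbsMeasure_real_dist1_ge_le (N := 2)
  -- merged per-plaquette constants for all heights `0 ≤ j ≤ K`
  set C₁ : ℝ := max C (2 * Real.exp 24 * (c₀ ^ 3)⁻¹) with hC₁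
  set A₁ : ℕ := max A 5 with hA₁
  set c₁ : ℝ := min c (1 / 4) with hc₁
  have hC₁0 : 0 ≤ C₁ := le_max_of_le_left hC
  have hc₁0 : 0 < c₁ := lt_min hc (by norm_num)
  have hc₁c : c₁ ≤ c := min_le_left _ _
  have hc₁4 : c₁ ≤ 1 / 4 := min_le_right _ _
  set M : ℝ := Real.exp (2 * (A₁ : ℝ) ^ 2 / (c₁ * b₀ ^ 2)) with hM
  refine ⟨c₁ / 2, 72 * (C₁ * M), by positivity, by positivity, ?_⟩
  intro F γ hFL hγ hγle K
  have hγ1 : γ ≤ 1 := hγle.trans hγ₁1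
  have hL1 : (1 : ℝ) < F.L := by exact_mod_cast F.hL.2
  have hL0 : (0 : ℝ) < F.L := one_pos.trans hL1
  haveI := isProbabilityMeasure_gibbsK F ℰp hγ.le K
  -- the couplings `x_i = γL^{-i} ∈ (0, 1]` and `β_i = x_i⁻¹ ≥ 1`
  have hx0 : ∀ i : ℕ, 0 < γ * ((F.L : ℝ)⁻¹) ^ i := fun i => mul_pos hγ (pow_pos (inv_pos.mpr hL0) i)
  have hx1 : ∀ i : ℕ, γ * ((F.L : ℝ)⁻¹) ^ i ≤ 1 := fun i => by
    have h1 : ((F.L : ℝ)⁻¹) ^ i ≤ 1 := pow_le_one₀ (inv_nonneg.mpr hL0.le) (inv_le_one_of_one_le₀ hL1.le)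
    calc γ * ((F.L : ℝ)⁻¹) ^ i ≤ 1 * 1 :=
          mul_le_mul hγ1 h1 (pow_nonneg (inv_nonneg.mpr hL0.le) i) zero_le_one
      _ = 1 := one_mul 1
  have hβ : ∀ i : ℕ, (F.scheme ℰp γ).β i = (γ * ((F.L : ℝ)⁻¹) ^ i)⁻¹ := fun i => rfl
  have hβ1 : ∀ i : ℕ, 1 ≤ (F.scheme ℰp γ).β i := fun i => by
    rw [hβ]; exact one_le_inv_iff₀.mpr ⟨hx0 i, hx1 i⟩
  -- `p(g_i) ≥ 0`
  have hp0 : ∀ i : ℕ, 0 ≤ B10.pFun b₀ p₀ (Real.sqrt (γ * ((F.L : ℝ)⁻¹) ^ i)) := fun i => by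
    show 0 ≤ b₀ * (1 + Real.log (Real.sqrt (γ * ((F.L : ℝ)⁻¹) ^ i))⁻¹) ^ p₀
    have h1 : 0 ≤ 1 + Real.log (Real.sqrt (γ * ((F.L : ℝ)⁻¹) ^ i))⁻¹ := by
      rw [Real.log_inv, Real.log_sqrt (hx0 i).le]
      have := Real.log_nonpos (hx0 i).le (hx1 i)
      linarith
    exact mul_nonneg hb₀.le (Real.rpow_nonneg h1 _)
  -- monotonicity of the schema in its constants (`β ≥ 1`)
  have hmono : ∀ (C' : ℝ) (A' : ℕ) (c' : ℝ), 0 ≤ C' → C' ≤ C₁ → A' ≤ A₁ → c₁ ≤ c' → ∀ i : ℕ,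
      C' * (F.scheme ℰp γ).β i ^ A' *
          Real.exp (-(c' * B10.pFun b₀ p₀ (Real.sqrt (γ * ((F.L : ℝ)⁻¹) ^ i)) ^ 2)) ≤
        C₁ * (F.scheme ℰp γ).β i ^ A₁ *
          Real.exp (-(c₁ * B10.pFun b₀ p₀ (Real.sqrt (γ * ((F.L : ℝ)⁻¹) ^ i)) ^ 2)) := by
    intro C' A' c' hC'0 hC' hA' hc' i
    have h1 : (F.scheme ℰp γ).β i ^ A' ≤ (F.scheme ℰp γ).β i ^ A₁ := pow_le_pow_right₀ (hβ1 i) hA'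
    have h2 : Real.exp (-(c' * B10.pFun b₀ p₀ (Real.sqrt (γ * ((F.L : ℝ)⁻¹) ^ i)) ^ 2)) ≤
        Real.exp (-(c₁ * B10.pFun b₀ p₀ (Real.sqrt (γ * ((F.L : ℝ)⁻¹) ^ i)) ^ 2)) := by
      refine Real.exp_le_exp.mpr ?_
      have := sq_nonneg (B10.pFun b₀ p₀ (Real.sqrt (γ * ((F.L : ℝ)⁻¹) ^ i)))
      nlinarith
    have hβ0 : 0 ≤ (F.scheme ℰp γ).β i ^ A₁ := pow_nonneg (zero_le_one.trans (hβ1 i)) _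
    calc C' * (F.scheme ℰp γ).β i ^ A' * Real.exp (-(c' * B10.pFun b₀ p₀ (Real.sqrt (γ * ((F.L : ℝ)⁻¹) ^ i)) ^ 2))
        ≤ C₁ * (F.scheme ℰp γ).β i ^ A₁ * Real.exp (-(c' * B10.pFun b₀ p₀ (Real.sqrt (γ * ((F.L : ℝ)⁻¹) ^ i)) ^ 2)) := by
          refine mul_le_mul_of_nonneg_right (mul_le_mul hC' h1 (pow_nonneg (zero_le_one.trans (hβ1 i)) _) hC₁0)
            (Real.exp_nonneg _)
      _ ≤ C₁ * (F.scheme ℰp γ).β i ^ A₁ * Real.exp (-(c₁ * B10.pFun b₀ p₀ (Real.sqrt (γ * ((F.L : ℝ)⁻¹) ^ i)) ^ 2)) :=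
          mul_le_mul_of_nonneg_left h2 (mul_nonneg hC₁0 hβ0)
  -- STEP 1: the per-plaquette bound at EVERY height `0 ≤ j ≤ K` with the merged constants
  have hall : ∀ j : ℕ, j ≤ K → ∀ p : Plaq (F.P K) j,
      (gibbsK F ℰp γ K).real
          {U | θBal F.L γ b₀ p₀ (K - j) ≤ GaugeGroup.dist1 (GaugeField.plaqHol
              (Averaging.iter (fun i => BlockAveraging.blockAvg (P := F.P K) (j := i) ℰp) j U) p)} ≤
        C₁ * (F.scheme ℰp γ).β (K - j) ^ A₁ *
          Real.exp (-(c₁ * B10.pFun b₀ p₀ (Real.sqrt (γ * ((F.L : ℝ)⁻¹) ^ (K - j))) ^ 2)) := by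
    intro j hjK p
    rcases Nat.eq_zero_or_pos j with rfl | hj1
    · -- the bare height: chessboard tail of the tree, `d = 3`, `N = 2`
      have hK0 : K - 0 = K := Nat.sub_zero K
      have hθ : 0 ≤ θBal F.L γ b₀ p₀ K := mul_nonneg (Real.sqrt_nonneg _) (hp0 K)
      have hp1 := hbare (F.P K) ((F.scheme ℰp γ).β K) (hβ1 K) (θBal F.L γ b₀ p₀ K) hθ p
      have hcard2 : Fintype.card {q : Fin (F.P K).d × Fin (F.P K).d // q.1 < q.2} = 3 := by
        rw [show (F.P K).d = 3 from rfl]; decide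
      have hd3 : (F.P K).d = 3 := rfl
      have hexp : (F.scheme ℰp γ).β K * θBal F.L γ b₀ p₀ K ^ 2 / (2 * (2 : ℕ)) =
          B10.pFun b₀ p₀ (Real.sqrt (γ * ((F.L : ℝ)⁻¹) ^ K)) ^ 2 / 4 := by
        rw [beta_mul_θBal_sq F hγ]; norm_num
      have hp2 : (gibbsK F ℰp γ K).real
          {U | θBal F.L γ b₀ p₀ K ≤ GaugeGroup.dist1 (GaugeField.plaqHol U p)} ≤
          2 * Real.exp 24 * (c₀ ^ 3)⁻¹ * Real.sqrt ((F.scheme ℰp γ).β K) ^ 9 *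
            Real.exp (-(B10.pFun b₀ p₀ (Real.sqrt (γ * ((F.L : ℝ)⁻¹) ^ K)) ^ 2 / 4)) := by
        rw [gibbsK_eq]
        refine hp1.trans (le_of_eq ?_)
        rw [hcard2, hd3, hexp]
        norm_num
      -- `(√β)⁹ ≤ β⁵ ≤ β^{A₁}`, `2e^{24}c₀⁻³ ≤ C₁`, `¼ ≥ c₁`
      have hs9 : Real.sqrt ((F.scheme ℰp γ).β K) ^ 9 ≤ (F.scheme ℰp γ).β K ^ 5 := sfwRun_sqrt_pow_nine_le (hβ1 K)
      have hp3 : (gibbsK F ℰp γ K).real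
          {U | θBal F.L γ b₀ p₀ K ≤ GaugeGroup.dist1 (GaugeField.plaqHol U p)} ≤
          (2 * Real.exp 24 * (c₀ ^ 3)⁻¹) * (F.scheme ℰp γ).β K ^ 5 *
            Real.exp (-((1 / 4) * B10.pFun b₀ p₀ (Real.sqrt (γ * ((F.L : ℝ)⁻¹) ^ K)) ^ 2)) := by
        refine hp2.trans ?_
        rw [show -(B10.pFun b₀ p₀ (Real.sqrt (γ * ((F.L : ℝ)⁻¹) ^ K)) ^ 2 / 4) =
          -((1 / 4) * B10.pFun b₀ p₀ (Real.sqrt (γ * ((F.L : ℝ)⁻¹) ^ K)) ^ 2) by ring]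
        have h24 : 0 ≤ 2 * Real.exp 24 * (c₀ ^ 3)⁻¹ := by positivity
        exact mul_le_mul_of_nonneg_right (mul_le_mul_of_nonneg_left hs9 h24) (Real.exp_nonneg _)
      rw [hK0]
      exact hp3.trans (hmono _ 5 (1 / 4) (by positivity) (le_max_right _ _) (le_max_right _ _) hc₁4 K)
    · exact (h F γ hFL hγ hγle K j hj1 hjK p).trans (hmono C A c hC (le_max_left _ _) (le_max_left _ _) hc₁c (K - j))
  -- STEP 2: per height, union over plaquettes, counting, absorption
  have hheight : ∀ j : ℕ, j ≤ K →
      (gibbsK F ℰp γ K).real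
          {U | ¬ PlaqSmall (θBal F.L γ b₀ p₀ (K - j))
            (Averaging.iter (fun i => BlockAveraging.blockAvg (P := F.P K) (j := i) ℰp) j U)} ≤
        72 * (C₁ * M) * (F.L : ℝ) ^ (3 * (F.m + (K - j))) *
          Real.exp (-(c₁ / 2 * B10.pFun b₀ p₀ (Real.sqrt (γ * ((F.L : ℝ)⁻¹) ^ (K - j))) ^ 2)) := by
    intro j hjK
    have hunion := real_not_plaqSmall_comp_le_sum (gibbsK F ℰp γ K)
      (fun U => Averaging.iter (fun i => BlockAveraging.blockAvg (P := F.P K) (j := i) ℰp) j U) (θBal F.L γ b₀ p₀ (K - j))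
    refine hunion.trans ?_
    refine (Finset.sum_le_sum fun p _ => hall j hjK p).trans ?_
    rw [Finset.sum_const, Finset.card_univ, nsmul_eq_mul]
    -- absorption of `β^{A₁}` at `x = γL^{-(K-j)}`
    have habs := sfwRun_inv_pow_mul_exp_le (hx0 (K - j)) (hx1 (K - j)) hb₀ hp₀ hc₁0 A₁
    rw [← hβ] at habs
    have hnonneg : 0 ≤ C₁ * (F.scheme ℰp γ).β (K - j) ^ A₁ *
        Real.exp (-(c₁ * B10.pFun b₀ p₀ (Real.sqrt (γ * ((F.L : ℝ)⁻¹) ^ (K - j))) ^ 2)) :=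
      mul_nonneg (mul_nonneg hC₁0 (pow_nonneg (zero_le_one.trans (hβ1 (K - j))) _)) (Real.exp_nonneg _)
    calc (Fintype.card (Plaq (F.P K) j) : ℝ) * (C₁ * (F.scheme ℰp γ).β (K - j) ^ A₁ *
          Real.exp (-(c₁ * B10.pFun b₀ p₀ (Real.sqrt (γ * ((F.L : ℝ)⁻¹) ^ (K - j))) ^ 2)))
        ≤ (72 * (F.L : ℝ) ^ (3 * (F.m + (K - j)))) * (C₁ * (F.scheme ℰp γ).β (K - j) ^ A₁ *
          Real.exp (-(c₁ * B10.pFun b₀ p₀ (Real.sqrt (γ * ((F.L : ℝ)⁻¹) ^ (K - j))) ^ 2))) :=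
          mul_le_mul_of_nonneg_right (sfwRun_card_plaq_le F hjK) hnonneg
      _ = (72 * (F.L : ℝ) ^ (3 * (F.m + (K - j)))) * C₁ * ((F.scheme ℰp γ).β (K - j) ^ A₁ *
          Real.exp (-(c₁ * B10.pFun b₀ p₀ (Real.sqrt (γ * ((F.L : ℝ)⁻¹) ^ (K - j))) ^ 2))) := by ring
      _ ≤ (72 * (F.L : ℝ) ^ (3 * (F.m + (K - j)))) * C₁ *
          (M * Real.exp (-(c₁ / 2 * B10.pFun b₀ p₀ (Real.sqrt (γ * ((F.L : ℝ)⁻¹) ^ (K - j))) ^ 2))) :=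
          mul_le_mul_of_nonneg_left habs (by positivity)
      _ = 72 * (C₁ * M) * (F.L : ℝ) ^ (3 * (F.m + (K - j))) *
          Real.exp (-(c₁ / 2 * B10.pFun b₀ p₀ (Real.sqrt (γ * ((F.L : ℝ)⁻¹) ^ (K - j))) ^ 2)) := by ring
  -- STEP 3: union over heights and re-indexing `i = K − j`
  have hsub := sfwRun_compl_histGood_zero_subset F (θBal F.L γ b₀ p₀) K
  calc (gibbsK F ℰp γ K).real (histGood F ℰp (θBal F.L γ b₀ p₀) K 0)ᶜ
      ≤ (gibbsK F ℰp γ K).real (⋃ j ∈ Finset.range (K + 1),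
          {U : GaugeField (F.P K) 0 (Matrix.specialUnitaryGroup (Fin 2) ℂ) |
            ¬ PlaqSmall (θBal F.L γ b₀ p₀ (K - j))
              (Averaging.iter (fun i => BlockAveraging.blockAvg (P := F.P K) (j := i) ℰp) j U)}) :=
        measureReal_mono hsub (measure_ne_top _ _)
    _ ≤ ∑ j ∈ Finset.range (K + 1), (gibbsK F ℰp γ K).real
          {U | ¬ PlaqSmall (θBal F.L γ b₀ p₀ (K - j))
            (Averaging.iter (fun i => BlockAveraging.blockAvg (P := F.P K) (j := i) ℰp) j U)} :=
        measureReal_biUnion_finset_le _ _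
    _ ≤ ∑ j ∈ Finset.range (K + 1), 72 * (C₁ * M) * (F.L : ℝ) ^ (3 * (F.m + (K - j))) *
          Real.exp (-(c₁ / 2 * B10.pFun b₀ p₀ (Real.sqrt (γ * ((F.L : ℝ)⁻¹) ^ (K - j))) ^ 2)) :=
        Finset.sum_le_sum fun j hj => hheight j (Nat.lt_succ_iff.mp (Finset.mem_range.mp hj))
    _ = ∑ i ∈ Finset.range (K + 1), 72 * (C₁ * M) * (F.L : ℝ) ^ (3 * (F.m + i)) *
          Real.exp (-(c₁ / 2 * B10.pFun b₀ p₀ (Real.sqrt (γ * ((F.L : ℝ)⁻¹) ^ i)) ^ 2)) := by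
        rw [← Finset.sum_range_reflect (fun i => 72 * (C₁ * M) * (F.L : ℝ) ^ (3 * (F.m + i)) *
          Real.exp (-(c₁ / 2 * B10.pFun b₀ p₀ (Real.sqrt (γ * ((F.L : ℝ)⁻¹) ^ i)) ^ 2))) (K + 1)]
        simp only [Nat.add_sub_cancel]

/-- **THE SAME UNDER THE STUB's QUANTIFIER PREFIX, CONCLUDING THE BODY OF `PerRunMass` VERBATIM**: a per-plaquette averaged-height
tail `∀ L, ∃ (b₀ > 0) (p₀ > 2) (γ₁ > 0) (C ≥ 0) A (c > 0), ∀ F (F.L = L), ∀ 0 < γ ≤ γ₁, ∀ K, ∀ 1 ≤ j ≤ K, ∀ p, Gibbs_K{…} ≤ C β^A e^{−c p²}`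
gives `∀ L, ∃ b₀ p₀ γ₁ c C, 0 < b₀ ∧ 2 < p₀ ∧ 0 < γ₁ ∧ 0 < c ∧ 0 ≤ C ∧ ∀ F γ, F.L = L → 0 < γ → γ ≤ γ₁ → ∀ K,
Gibbs_K((histGood F ℰp (θBal F.L γ b₀ p₀) K 0)ᶜ) ≤ Σ_{i ≤ K} C·L^{3(m+i)}·exp(−c·p(g_i)²)` (threshold shrunk to `min γ₁ 1`). -/
theorem perRunMass_of_perPlaquetteTail'
    (h : ∀ L : ℕ, ∃ (b₀ p₀ γ₁ C : ℝ) (A : ℕ) (c : ℝ), 0 < b₀ ∧ 2 < p₀ ∧ 0 < γ₁ ∧ 0 ≤ C ∧ 0 < c ∧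
      ∀ (F : T3Family) (γ : ℝ), F.L = L → 0 < γ → γ ≤ γ₁ → ∀ (K j : ℕ), 1 ≤ j → j ≤ K →
        ∀ p : Plaq (F.P K) j,
          (gibbsK F ℰp γ K).real
              {U | θBal F.L γ b₀ p₀ (K - j) ≤
                GaugeGroup.dist1 (GaugeField.plaqHol
                  (Averaging.iter (fun i => BlockAveraging.blockAvg (P := F.P K) (j := i) ℰp) j U) p)} ≤
            C * (F.scheme ℰp γ).β (K - j) ^ A *
              Real.exp (-(c * B10.pFun b₀ p₀ (Real.sqrt (γ * ((F.L : ℝ)⁻¹) ^ (K - j))) ^ 2))) :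
    ∀ (L : ℕ), ∃ (b₀ p₀ γ₁ c C : ℝ), 0 < b₀ ∧ 2 < p₀ ∧ 0 < γ₁ ∧ 0 < c ∧ 0 ≤ C ∧
      ∀ (F : T3Family) (γ : ℝ), F.L = L → 0 < γ → γ ≤ γ₁ → ∀ K : ℕ,
        (gibbsK F ℰp γ K).real (histGood F ℰp (θBal F.L γ b₀ p₀) K 0)ᶜ ≤
          ∑ i ∈ Finset.range (K + 1), C * (F.L : ℝ) ^ (3 * (F.m + i)) *
            Real.exp (-(c * (B10.pFun b₀ p₀ (Real.sqrt (γ * ((F.L : ℝ)⁻¹) ^ i))) ^ 2)) := by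
  intro L
  obtain ⟨b₀, p₀, γ₁, C, A, c, hb₀, hp₀, hγ₁, hC, hc, hL⟩ := h L
  obtain ⟨c', C', hc', hC', hrun⟩ := perRunMass_of_perPlaquetteTail L (γ₁ := min γ₁ 1) hb₀ (by linarith)
    (min_le_right _ _) hC hc
    (fun F γ hFL hγ hγle K j hj hjK p => hL F γ hFL hγ (hγle.trans (min_le_left _ _)) K j hj hjK p)
  exact ⟨b₀, p₀, min γ₁ 1, c', C', hb₀, hp₀, lt_min hγ₁ one_pos, hc', hC', hrun⟩

end Summit.QuantumFields.YangMills.Theorems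

end
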